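import Literature.Algebra.Polynomial.CasasAlvero.Descent
import Literature.Algebra.Polynomial.CasasAlvero.Degree6
import Mathlib.RingTheory.Nullstellensatz
import Mathlib.RingTheory.MvPolynomial.Localization
import Mathlib.RingTheory.MvPolynomial.Tower
import Mathlib.FieldTheory.IsAlgClosed.AlgebraicClosure
import Mathlib.Algebra.Algebra.Rat
import HarnessLib

/-!
# Casas-Alvero: finiteness of the set of bad primes of a good degree

[GvBLSW 2007, Prop. 2]: for each degree `d`, EITHER the Casas-Alvero property `CA_d` fails in characteristic `0`
and in EVERY positive characteristic, OR it holds in characteristic `0` and in all but FINITELY MANY positive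
characteristics (the "bad primes for degree `d`" of [CLO 2012, §1]).  The first alternative is `Transfer.lean`;
this file proves the second:

* `exists_bound_badPrimes` — if `CA_d` holds over one algebraically closed field of characteristic `0`, there is an
  integer `N ≠ 0` such that `CA_d` holds over EVERY field of EVERY prime characteristic `p ∤ N`;
* `finite_badPrimes` — hence the set of primes `p` admitting a field of characteristic `p` where `CA_d` fails is
  finite; contrapositively (`not_holdsInDegree_charZero_of_infinite_badPrimes`) infinitely many bad primes force a
  counterexample in characteristic `0`;
* `exists_bound_badPrimes_of_le_six` — unconditionally for `d ≤ 6` (with `Degree6.lean`).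

PROOF (the paper: `X_d → Spec ℤ` is projective, so its image is closed; here made elementary and constructive in
shape).  Fix `d` and work in the "root chart": the polynomial ring `ℤ[x_0, …, x_{d-1}, z]`, the generic monic
polynomial `P = ∏ (X - x_m)` and, for each PATTERN `π = (j, a, b)` (a witness slot `j_i` for every Hasse index
`0 < i < d` and two slots `a, b`), the finite system `S_π = {H^i P (x_{j_i}) : 0 < i < d} ∪ {(x_a - x_b) z - 1}`.
Over any field, a zero of some `S_π` is exactly a monic Casas-Alvero polynomial of degree `d` with two distinct
roots (`not_holdsInDegree_of_rootSystem_zero`, `exists_rootSystem_zero_of_not_holdsInDegree`).  If `CA_d` holds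
over an algebraically closed `K ⊇ ℚ`, no `S_π` has a `K`-zero, so by Hilbert's Nullstellensatz
(`MvPolynomial.eq_vanishingIdeal_singleton_of_isMaximal`) `S_π` generates the unit ideal of `ℚ[x, z]`; since
`ℚ[x, z]` is the localisation of `ℤ[x, z]` at `ℤ ∖ 0` (`MvPolynomial.isLocalization`), clearing denominators gives a
non-zero integer `N_π ∈ (S_π) ⊆ ℤ[x, z]`.  With `N = ∏_π |N_π|` (finitely many patterns), a zero of `S_π` over a
field of characteristic `p` kills `N_π`, so `p ∣ N`.
-/

noncomputable section

open Polynomial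

namespace Literature.Algebra.Polynomial.CasasAlvero

universe u v

section Generic

variable {R T : Type*} [CommRing R] [CommRing T]

/-- a ring map commutes with "evaluate the `i`-th Hasse derivative at a point". [folklore] -/
private theorem map_eval_hasseDeriv' (ψ : R →+* T) (i : ℕ) (P : R[X]) (q : R) :
    ψ ((hasseDeriv i P).eval q) = (hasseDeriv i (P.map ψ)).eval (ψ q) := by
  rw [hasseDeriv_map, eval_map, eval₂_hom]

end Generic

section RootSystem

variable (d : ℕ)

/-- The Hasse indices `0 < i < d` of the Casas-Alvero conditions in degree `d`.
[cite: GrafVonBothmerEtAl2007, §2 (proof of Prop. 2)] -/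
abbrev HasseIdx : Type := {i : Fin d // 0 < (i : ℕ)}

/-- A PATTERN: a witness slot for every Hasse index and two root slots required to be distinct.
[cite: GrafVonBothmerEtAl2007, §2 (proof of Prop. 2)] -/
abbrev Pattern : Type := (HasseIdx d → Fin d) × Fin d × Fin d

/-- The generic monic polynomial `∏_{m < d} (X - x_m)` over `ℤ[x_0, …, x_{d-1}, z]` (variables `some m ↦ x_m`,
`none ↦ z`). [cite: GrafVonBothmerEtAl2007, §2 (proof of Prop. 2)] -/
def genericPoly : (MvPolynomial (Option (Fin d)) ℤ)[X] :=
  ∏ m : Fin d, (X - C (MvPolynomial.X (some m)))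

/-- The system `S_π = {H^i P (x_{j_i}) : 0 < i < d} ∪ {(x_a - x_b) z - 1}` of the pattern `π = (j, a, b)`: its zeros
over a field are the monic Casas-Alvero polynomials of degree `d` with roots `x_a ≠ x_b` and witnesses `x_{j_i}`
(an affine chart of the scheme `X_d` of [GvBLSW 2007]). [cite: GrafVonBothmerEtAl2007, §2 (proof of Prop. 2)] -/
def rootSystem (π : Pattern d) : Set (MvPolynomial (Option (Fin d)) ℤ) :=
  insert ((MvPolynomial.X (some π.2.1) - MvPolynomial.X (some π.2.2)) * MvPolynomial.X none - 1)
    (Set.range fun i : HasseIdx d =>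
      (hasseDeriv ((i : Fin d) : ℕ) (genericPoly d)).eval (MvPolynomial.X (some (π.1 i))))

variable {d}

/-- specialising the generic polynomial at a point. [folklore] -/
private theorem map_genericPoly {F : Type*} [CommRing F] (x : Option (Fin d) → F) :
    (genericPoly d).map (MvPolynomial.aeval x).toRingHom = ∏ m : Fin d, (X - C (x (some m))) := by
  rw [genericPoly, Polynomial.map_prod]
  refine Finset.prod_congr rfl fun m _ => ?_
  rw [Polynomial.map_sub, map_X, map_C, AlgHom.toRingHom_eq_coe, RingHom.coe_coe, MvPolynomial.aeval_X]

/-- A zero of `S_π` over a field `F` is a counterexample to `CA_d(F)`. [cite: GrafVonBothmerEtAl2007, §2 (proof of Prop. 2)] -/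
theorem not_holdsInDegree_of_rootSystem_zero {F : Type*} [Field F] (π : Pattern d) (x : Option (Fin d) → F)
    (hx : ∀ q ∈ rootSystem d π, MvPolynomial.aeval x q = 0) : ¬ HoldsInDegree F d := by
  classical
  intro h
  set fF : F[X] := ∏ m : Fin d, (X - C (x (some m))) with hfF
  have hmap : (genericPoly d).map (MvPolynomial.aeval x).toRingHom = fF := map_genericPoly x
  have hmonic : fF.Monic := monic_prod_of_monic _ _ fun m _ => monic_X_sub_C (x (some m))
  have hdeg : fF.natDegree = d := by
    rw [hfF, natDegree_prod_of_monic _ _ fun m _ => monic_X_sub_C (x (some m))]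
    simp
  have heval : ∀ m : Fin d, fF.eval (x (some m)) = 0 := fun m => by
    rw [hfF, eval_prod]
    exact Finset.prod_eq_zero (Finset.mem_univ m) (by simp)
  have hca : IsCasasAlvero fF := by
    intro i hi0 hi
    rw [hdeg] at hi
    refine ⟨x (some (π.1 ⟨⟨i, hi⟩, hi0⟩)), heval _, ?_⟩
    have h0 := hx _ (Set.mem_insert_of_mem _ ⟨⟨⟨i, hi⟩, hi0⟩, rfl⟩)
    have h1 : (MvPolynomial.aeval x).toRingHom
        ((hasseDeriv i (genericPoly d)).eval (MvPolynomial.X (some (π.1 ⟨⟨i, hi⟩, hi0⟩)))) = 0 := h0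
    rw [map_eval_hasseDeriv', hmap, AlgHom.toRingHom_eq_coe, RingHom.coe_coe, MvPolynomial.aeval_X] at h1
    exact h1
  obtain ⟨c, hc⟩ := h fF hmonic hdeg hca
  have hd : d ≠ 0 := Nat.pos_iff_ne_zero.mp π.2.1.pos
  have hroot : ∀ m : Fin d, x (some m) = c := fun m => by
    have h0 := heval m
    rw [hc, eval_pow, eval_sub, eval_X, eval_C] at h0
    exact sub_eq_zero.mp ((pow_eq_zero_iff hd).mp h0)
  have hG := hx _ (Set.mem_insert _ _)
  rw [map_sub, map_mul, map_sub, map_one, MvPolynomial.aeval_X, MvPolynomial.aeval_X, hroot, hroot, sub_self,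
    zero_mul, zero_sub, neg_eq_zero] at hG
  exact one_ne_zero hG

/-- Conversely, over an algebraically closed field a counterexample to `CA_d` is a zero of some `S_π`.
[cite: GrafVonBothmerEtAl2007, §2 (proof of Prop. 2)] -/
theorem exists_rootSystem_zero_of_not_holdsInDegree {F : Type*} [Field F] [IsAlgClosed F]
    (h : ¬ HoldsInDegree F d) :
    ∃ (π : Pattern d) (x : Option (Fin d) → F), ∀ q ∈ rootSystem d π, MvPolynomial.aeval x q = 0 := by
  classical
  unfold HoldsInDegree at h
  push Not at h
  obtain ⟨f, hf, hfd, hca, hne⟩ := h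
  set s : Multiset F := f.roots with hs_def
  have hcard : Multiset.card s = d := by rw [hs_def, IsAlgClosed.card_roots_eq_natDegree, hfd]
  have hprod : (s.map fun a => X - C a).prod = f :=
    prod_multiset_X_sub_C_of_monic_of_roots_card_eq hf (by rw [IsAlgClosed.card_roots_eq_natDegree])
  obtain ⟨l, hl⟩ : ∃ l : List F, (l : Multiset F) = s := ⟨s.toList, Multiset.coe_toList s⟩
  have hlen : l.length = d := by rw [← Multiset.coe_card, hl, hcard]
  subst hlen
  -- enumerated factorisation
  have hofFn : (List.ofFn fun m : Fin l.length => X - C (l.get m)) = l.map fun θ => X - C θ := by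
    rw [List.ofFn_comp' l.get (fun θ : F => X - C θ), List.ofFn_get]
  have hprodr : ∏ m : Fin l.length, (X - C (l.get m)) = f := by
    rw [← hprod, ← hl, Multiset.map_coe, Multiset.prod_coe, ← List.prod_ofFn, hofFn]
  -- two distinct roots
  have h2 : ∃ a b : Fin l.length, l.get a ≠ l.get b := by
    by_contra hall
    push Not at hall
    rcases Nat.eq_zero_or_pos l.length with h0 | hpos
    · refine hne 0 ?_
      rw [h0, pow_zero]
      exact (Monic.natDegree_eq_zero hf).mp (hfd.trans h0)
    · refine hne (l.get ⟨0, hpos⟩) ?_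
      rw [← hprodr, Finset.prod_congr rfl fun m _ => by rw [hall m ⟨0, hpos⟩], Finset.prod_const,
        Finset.card_univ, Fintype.card_fin]
  obtain ⟨a, b, hab⟩ := h2
  -- witnesses
  have hw : ∀ i : HasseIdx l.length, ∃ m : Fin l.length,
      (hasseDeriv ((i : Fin l.length) : ℕ) f).eval (l.get m) = 0 := by
    intro i
    obtain ⟨θ, hθf, hθH⟩ := hca i i.2 (by rw [hfd]; exact i.1.isLt)
    have hθl : θ ∈ l := by
      rw [← Multiset.mem_coe, hl, hs_def, mem_roots hf.ne_zero]
      exact hθf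
    obtain ⟨m, hm⟩ := List.mem_iff_get.mp hθl
    exact ⟨m, by rw [hm]; exact hθH⟩
  choose j hj using hw
  let x : Option (Fin l.length) → F := fun o => o.elim ((l.get a - l.get b)⁻¹) l.get
  have hmapf : (genericPoly l.length).map (MvPolynomial.aeval x).toRingHom = f := by
    rw [map_genericPoly]; exact hprodr
  refine ⟨(j, a, b), x, ?_⟩
  intro q hq
  rcases hq with rfl | ⟨i, rfl⟩
  · rw [map_sub, map_mul, map_sub, map_one, MvPolynomial.aeval_X, MvPolynomial.aeval_X, MvPolynomial.aeval_X]
    change (l.get a - l.get b) * (l.get a - l.get b)⁻¹ - 1 = 0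
    rw [mul_inv_cancel₀ (sub_ne_zero.mpr hab), sub_self]
  · change (MvPolynomial.aeval x).toRingHom
        ((hasseDeriv ((i : Fin l.length) : ℕ) (genericPoly l.length)).eval (MvPolynomial.X (some (j i)))) = 0
    rw [map_eval_hasseDeriv', hmapf, AlgHom.toRingHom_eq_coe, RingHom.coe_coe, MvPolynomial.aeval_X]
    exact hj i

end RootSystem

section Denominators

attribute [local instance] MvPolynomial.algebraMvPolynomial

/-- `CA_d` over an algebraically closed field of characteristic `0` puts a NON-ZERO INTEGER into every ideal
`(S_π) ⊆ ℤ[x, z]` (Nullstellensatz over `ℚ`, then clearing denominators).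
[cite: GrafVonBothmerEtAl2007, Prop. 2] -/
theorem exists_int_mem_span_rootSystem {K : Type v} [Field K] [IsAlgClosed K] [CharZero K] {d : ℕ}
    (h : HoldsInDegree K d) (π : Pattern d) :
    ∃ N : ℤ, N ≠ 0 ∧ MvPolynomial.C N ∈ Ideal.span (rootSystem d π) := by
  classical
  let φ : MvPolynomial (Option (Fin d)) ℤ →+* MvPolynomial (Option (Fin d)) ℚ :=
    MvPolynomial.map (algebraMap ℤ ℚ)
  have hφ : φ = algebraMap (MvPolynomial (Option (Fin d)) ℤ) (MvPolynomial (Option (Fin d)) ℚ) :=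
    (MvPolynomial.algebraMap_def).symm
  -- Nullstellensatz over `ℚ`: `S_π` generates the unit ideal of `ℚ[x, z]`
  have htop : Ideal.map φ (Ideal.span (rootSystem d π)) = ⊤ := by
    by_contra hne
    obtain ⟨M, hM, hle⟩ := Ideal.exists_le_maximal _ hne
    obtain ⟨x, hx⟩ := MvPolynomial.eq_vanishingIdeal_singleton_of_isMaximal K hM
    refine not_holdsInDegree_of_rootSystem_zero π x (fun q hq => ?_) h
    have hqM : φ q ∈ MvPolynomial.vanishingIdeal ℚ {x} :=
      hx ▸ hle (Ideal.mem_map_of_mem φ (Ideal.subset_span hq))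
    have h0 := (MvPolynomial.mem_vanishingIdeal_singleton_iff x (φ q)).mp hqM
    rwa [MvPolynomial.aeval_map_algebraMap ℚ x q] at h0
  have h1 : (1 : MvPolynomial (Option (Fin d)) ℚ) ∈
      Ideal.map (algebraMap _ (MvPolynomial (Option (Fin d)) ℚ)) (Ideal.span (rootSystem d π)) := by
    rw [← hφ, htop]; exact Submodule.mem_top
  -- clearing denominators: `ℚ[x, z]` is the localisation of `ℤ[x, z]` at `ℤ ∖ 0`
  obtain ⟨⟨⟨q, hq⟩, ⟨m, hm⟩⟩, hqm⟩ :=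
    (IsLocalization.mem_map_algebraMap_iff ((nonZeroDivisors ℤ).map MvPolynomial.C)
      (MvPolynomial (Option (Fin d)) ℚ)).mp h1
  simp only [one_mul] at hqm
  have hinj : Function.Injective
      (algebraMap (MvPolynomial (Option (Fin d)) ℤ) (MvPolynomial (Option (Fin d)) ℚ)) := by
    rw [← hφ]; exact MvPolynomial.map_injective _ (algebraMap ℤ ℚ).injective_int
  have hqm' : m = q := hinj hqm
  obtain ⟨N, hN, rfl⟩ := Submonoid.mem_map.mp hm
  exact ⟨N, nonZeroDivisors.ne_zero hN, hqm' ▸ hq⟩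

end Denominators

section Finiteness

/-- **Finiteness of bad primes** [GvBLSW 2007, Prop. 2, second alternative]: if `CA_d` holds over an algebraically
closed field of characteristic `0`, then there is `N ≠ 0` such that `CA_d` holds over every field of every prime
characteristic `p ∤ N`. [cite: GrafVonBothmerEtAl2007, Prop. 2] -/
theorem exists_bound_badPrimes {K : Type v} [Field K] [IsAlgClosed K] [CharZero K] {d : ℕ}
    (h : HoldsInDegree K d) :
    ∃ N : ℕ, N ≠ 0 ∧ ∀ p : ℕ, p.Prime → ¬ p ∣ N →
      ∀ (F : Type u) [Field F] [CharP F p], HoldsInDegree F d := by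
  classical
  choose Nπ hNπ hCπ using exists_int_mem_span_rootSystem h
  refine ⟨∏ π : Pattern d, (Nπ π).natAbs, ?_, ?_⟩
  · exact Finset.prod_ne_zero_iff.mpr fun π _ => Int.natAbs_ne_zero.mpr (hNπ π)
  · intro p hp hpN F _ _
    haveI : Fact p.Prime := ⟨hp⟩
    haveI : CharP (AlgebraicClosure F) p := (Algebra.charP_iff F (AlgebraicClosure F) p).mp inferInstance
    refine HoldsInDegree.descend (algebraMap F (AlgebraicClosure F)) ?_
    by_contra hbar
    obtain ⟨π, x, hx⟩ := exists_rootSystem_zero_of_not_holdsInDegree hbar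
    have hker : Ideal.span (rootSystem d π) ≤ RingHom.ker (MvPolynomial.aeval x).toRingHom :=
      Ideal.span_le.mpr fun q hq => hx q hq
    have h0 : (MvPolynomial.aeval x) (MvPolynomial.C (Nπ π) : MvPolynomial (Option (Fin d)) ℤ) = 0 :=
      hker (hCπ π)
    rw [MvPolynomial.algHom_C, eq_intCast, CharP.intCast_eq_zero_iff (AlgebraicClosure F) p]
      at h0
    exact hpN ((Int.natCast_dvd.mp h0).trans (Finset.dvd_prod_of_mem _ (Finset.mem_univ π)))

/-- The set of BAD PRIMES for degree `d` — primes `p` such that `CA_d` fails over some field of characteristic `p`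
[CLO 2012, §1] — is finite as soon as `CA_d` holds over an algebraically closed field of characteristic `0`.
[cite: GrafVonBothmerEtAl2007, Prop. 2] [cite: CastryckLaterveerOunaies2012, §1] -/
theorem finite_badPrimes {K : Type v} [Field K] [IsAlgClosed K] [CharZero K] {d : ℕ} (h : HoldsInDegree K d) :
    {p : ℕ | p.Prime ∧ ∃ (F : Type u) (_ : Field F) (_ : CharP F p), ¬ HoldsInDegree F d}.Finite := by
  obtain ⟨N, hN, hgood⟩ := exists_bound_badPrimes.{u} h
  refine (Finset.finite_toSet N.primeFactors).subset ?_
  rintro p ⟨hp, F, hF, hFp, hbad⟩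
  simp only [Finset.mem_coe, Nat.mem_primeFactors]
  refine ⟨hp, ?_, hN⟩
  by_contra hpN
  exact hbad (hgood p hp hpN F)

/-- Contrapositive: if `CA_d` fails in infinitely many prime characteristics, it fails over every algebraically
closed field of characteristic `0`. [cite: GrafVonBothmerEtAl2007, Prop. 2] -/
theorem not_holdsInDegree_charZero_of_infinite_badPrimes {d : ℕ}
    (hinf : {p : ℕ | p.Prime ∧ ∃ (F : Type u) (_ : Field F) (_ : CharP F p), ¬ HoldsInDegree F d}.Infinite)
    (K : Type v) [Field K] [IsAlgClosed K] [CharZero K] : ¬ HoldsInDegree K d :=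
  fun h => hinf (finite_badPrimes.{u} h)

/-- Unconditionally for `d ≤ 6` (`CA_d` holds in characteristic `0` for `d ≤ 6`, `Degree6.lean`): all but finitely
many primes are good for degree `d`. [cite: GrafVonBothmerEtAl2007, Prop. 2] [cite: CastryckLaterveerOunaies2012, Thm. 4] -/
theorem exists_bound_badPrimes_of_le_six {d : ℕ} (hd : d ≤ 6) :
    ∃ N : ℕ, N ≠ 0 ∧ ∀ p : ℕ, p.Prime → ¬ p ∣ N →
      ∀ (F : Type u) [Field F] [CharP F p], HoldsInDegree F d :=
  exists_bound_badPrimes (holdsInDegree_of_le_six_of_charZero (K := AlgebraicClosure ℚ) hd)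

/-- For `d ≤ 6` the set of bad primes is finite. [cite: GrafVonBothmerEtAl2007, Prop. 2]
[cite: CastryckLaterveerOunaies2012, Thm. 4] -/
theorem finite_badPrimes_of_le_six {d : ℕ} (hd : d ≤ 6) :
    {p : ℕ | p.Prime ∧ ∃ (F : Type u) (_ : Field F) (_ : CharP F p), ¬ HoldsInDegree F d}.Finite :=
  finite_badPrimes (holdsInDegree_of_le_six_of_charZero (K := AlgebraicClosure ℚ) hd)

end Finiteness

end Literature.Algebra.Polynomial.CasasAlvero
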